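import Mathlib
import HarnessLib

/-!
# Road T for item 23110, H-FIN glue (pure algebra): bounded exponent of the `u`-eigenclasses for generic `u` from a DETECTING family
# with finite-eigenvalue targets and a finite-eigenvalue kernel

Route `ResidualThetaTransportAtTwo` (RTT, crux r201 `ResidualLambdaFormulaNegDiscAtTwo`, stmt-BirchSwinnertonDyer-23110) /
`ThetaPartnerAtTwo` (TP2). Seat `prover-bsd-wall-tp2-p2x-w3` g12; `--supports stmt-BirchSwinnertonDyer-23110`. THEOREMS ONLY (no
definition, no named fact, no `sorry`); pure algebra (imports `Mathlib` only); closes nothing.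

The input H-FIN(u) of road T's doors reads «`∃ e, ∀ c ∈ Sel♯_{S₀}, conj_γ c = u·c → p^e c = 0`» for all odd `u` outside a finite set.
The lead's reduction (memo RLF-TWIST-ROAD-g12 v3, §hfinE): the detecting map `c ↦ (r_v(conj_{γⁿ} c))_{v ∈ S₀, n < N_v}` on `Sel♯_{S₀}` has
kernel `Sel♯_∅ = Sel^ε(E/K_∞)` (`detect_eq_zero_iff_mem_sharp_empty`, `signedSelmerInfty_eq_sharp_empty`), whose `u`-eigenclasses are
finite for all but finitely many `u` (`SignedSelmerDualData.finite_setOf_int_infinite_conjH1_eq_zsmul`, cotorsion of `X`); a `u`-eigenclass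
is detected inside the `u^{N_v}`-eigenspaces of an endomorphism `Φ_v` (`conj'_{g_v}`, `γ^{N_v} ∈ ker κ · g_v`) of the local targets `Y_v`,
and a `p`-primary `Y_v` with finite `p`-torsion has only finitely many `w` with infinite `w`-eigenspace
(`PrimaryTorsionEigen.finite_setOf_infinite_eigenspace`). THIS FILE is the abstract counting step that turns these four facts into
H-FIN(u) for generic `u`; every object is a parameter (an additive group `H` with an endomorphism `C`, subgroups `S∅ ≤ S`-kernel, a finite
family of targets `Y i` with additive maps `r i : H →+ Y i`, self-maps `Φ i` and exponents `M i ≥ 1`; `S₀` need not lie in `S`), so the lead instantiates it with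
the tree's `r_v`, `conj'`, `N_v` without this file knowing their types.

* `finite_setOf_pow_eq` — `{u : ℤ | u ^ M = w}` is finite for `M ≥ 1`.
* `finite_eigenclasses_of_detect` — for `u` with finite kernel-eigenset and finite target eigenspaces at `u^{M i}`, the `u`-eigenset
  of `S` is finite (fibres of the detecting map over a finite product are translates of the kernel-eigenset).
* **`exists_finite_forall_eigenclass_exponent_of_detect`** — ∃ `B` finite, ∀ `u ∉ B` with `P u`: `∃ e, ∀ c ∈ S, C c = u • c → p^e • c = 0`
  (the shape of H-FIN(u), `P u` = «`p ∣ u − 1`» or anything).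

HONEST FRAMING: pure algebra; closes nothing; 23110 is NOT proved; BSD is not proved by any of this.
References: [GreenbergLNM1716] §4 pp. 113, 122–124 (finiteness of `S_{A_{−s}}(F)` for almost all `s`); [GreenbergVatsal2000] §2 p. 20.
-/

set_option autoImplicit false
-- the Theorems namespace of this sub repeats the summit name by design (D-0017 nested layout)
set_option linter.dupNamespace false

namespace Summit.BirchSwinnertonDyer.BirchSwinnertonDyer.Theorems.SignedEC.EigenGlue

/-- `{u : ℤ | u ^ M = w}` is finite when `M ≥ 1` (`|u| ≤ |u|^M = |w|` unless `u = 0`). [cite: GreenbergLNM1716, §4 p. 124] -/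
theorem finite_setOf_pow_eq {M : ℕ} (hM : 1 ≤ M) (w : ℤ) : {u : ℤ | u ^ M = w}.Finite := by
  refine (Set.finite_Icc (-|w|) |w|).subset fun u hu ↦ ?_
  have hu : u ^ M = w := hu
  have hle : |u| ≤ |w| := by
    rcases eq_or_ne u 0 with h0 | h0
    · rw [h0, abs_zero]; exact abs_nonneg w
    · rw [← hu, abs_pow]
      have h1 : 1 ≤ |u| := Int.one_le_abs h0
      calc |u| = |u| ^ 1 := (pow_one _).symm
        _ ≤ |u| ^ M := pow_le_pow_right₀ h1 hM
  exact Set.mem_Icc.2 ⟨by linarith [neg_abs_le u], le_trans (le_abs_self u) hle⟩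

variable {H : Type*} [AddCommGroup H] (C : H →+ H) (S S₀ : AddSubgroup H) {ι : Type*} [Fintype ι]
  {Y : ι → Type*} [∀ i, AddCommGroup (Y i)] (r : ∀ i, H →+ Y i) (Φ : ∀ i, Y i → Y i) (M : ι → ℕ)

/-- **Finiteness of the `u`-eigenclasses from a detecting family.** If the kernel of the detecting family `(r i)_i` on `S` lies in `S₀`
(`hker`), `u`-eigenclasses of `C` are detected inside the `u^{M i}`-eigenspaces of `Φ i` (`heig`), these eigenspaces are finite (`hY`) and
the `u`-eigenclasses of `C` in `S₀` are finite (`hK`), then the `u`-eigenclasses of `C` in `S` are finite: the detecting map sends them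
into a finite product, and two of them with the same image differ by a `u`-eigenclass of `S₀`. [cite: GreenbergLNM1716, §4 pp. 122–124]
[cite: GreenbergVatsal2000, §2 p. 20] -/
theorem finite_eigenclasses_of_detect (hker : ∀ c ∈ S, (∀ i, r i c = 0) → c ∈ S₀) (u : ℤ)
    (heig : ∀ c ∈ S, C c = u • c → ∀ i, Φ i (r i c) = u ^ M i • r i c)
    (hY : ∀ i, {y : Y i | Φ i y = u ^ M i • y}.Finite)
    (hK : {c : H | c ∈ S₀ ∧ C c = u • c}.Finite) :
    {c : H | c ∈ S ∧ C c = u • c}.Finite := by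
  classical
  -- the detecting map into the finite product of the eigenspaces
  let f : H → (∀ i, Y i) := fun c i ↦ r i c
  set F : Set H := {c : H | c ∈ S ∧ C c = u • c} with hF
  have himg : (f '' F).Finite := by
    refine (Set.Finite.pi (t := fun i ↦ {y : Y i | Φ i y = u ^ M i • y}) hY).subset ?_
    rintro _ ⟨c, hc, rfl⟩
    exact Set.mem_univ_pi.2 fun i ↦ heig c hc.1 hc.2 i
  -- `F` is covered by the fibres over its (finite) image, each a translate of the finite kernel-eigenset
  have hcover : F ⊆ ⋃ y ∈ f '' F, {c : H | c ∈ F ∧ f c = y} := fun c hc ↦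
    Set.mem_iUnion₂.2 ⟨f c, Set.mem_image_of_mem f hc, hc, rfl⟩
  refine (himg.biUnion fun y hy ↦ ?_).subset hcover
  obtain ⟨c₀, hc₀, rfl⟩ := hy
  refine ((hK.image fun k ↦ c₀ + k).subset ?_)
  rintro c ⟨hc, hfc⟩
  refine ⟨c - c₀, ⟨?_, ?_⟩, add_sub_cancel c₀ c⟩
  · refine hker _ (S.sub_mem hc.1 hc₀.1) fun i ↦ ?_
    have h := congrFun hfc i
    simp only [f] at h
    rw [map_sub, h, sub_self]
  · rw [map_sub, hc.2, hc₀.2, zsmul_sub]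

/-- **H-FIN(u) for generic `u` from a detecting family** (the counting glue of road T's H-FIN). Hypotheses: subgroups `S`, `S₀` of `H`
with the elements of `S` `p`-power torsion (`htor`); the kernel of the detecting family on `S` lies in `S₀` (`hker`); `u`-eigenclasses are
detected in `u^{M i}`-eigenspaces, `M i ≥ 1` (`heig`, `hM`); every target has only finitely many `w` with infinite `w`-eigenspace (`hY`);
the `u`-eigenclasses of `S₀` are finite for all `u` with `P u` outside a finite set (`hK`). THEN outside a finite set of `u`, `P u` implies
that ONE power `p^e` kills every `u`-eigenclass of `C` in `S`. [cite: GreenbergLNM1716, §4 pp. 113 and 122–124]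
[cite: GreenbergVatsal2000, §2 p. 20] -/
theorem exists_finite_forall_eigenclass_exponent_of_detect {p : ℕ} (P : ℤ → Prop)
    (htor : ∀ c ∈ S, ∃ k : ℕ, p ^ k • c = 0)
    (hker : ∀ c ∈ S, (∀ i, r i c = 0) → c ∈ S₀)
    (heig : ∀ (u : ℤ), ∀ c ∈ S, C c = u • c → ∀ i, Φ i (r i c) = u ^ M i • r i c) (hM : ∀ i, 1 ≤ M i)
    (hY : ∀ i, {w : ℤ | {y : Y i | Φ i y = w • y}.Infinite}.Finite)
    (hK : {u : ℤ | P u ∧ {c : H | c ∈ S₀ ∧ C c = u • c}.Infinite}.Finite) :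
    ∃ B : Set ℤ, B.Finite ∧ ∀ u : ℤ, u ∉ B → P u → ∃ e : ℕ, ∀ c ∈ S, C c = u • c → p ^ e • c = 0 := by
  classical
  -- the exceptional set: bad `u` for the kernel, and `u` with `u^{M i}` a bad eigenvalue of some target
  refine ⟨{u : ℤ | P u ∧ {c : H | c ∈ S₀ ∧ C c = u • c}.Infinite} ∪
      ⋃ i : ι, ⋃ w ∈ {w : ℤ | {y : Y i | Φ i y = w • y}.Infinite}, {u : ℤ | u ^ M i = w},
    hK.union (Set.finite_iUnion fun i ↦ (hY i).biUnion fun w _ ↦ finite_setOf_pow_eq (hM i) w), ?_⟩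
  intro u huB hPu
  rw [Set.mem_union, not_or] at huB
  obtain ⟨huK, huY⟩ := huB
  have hKfin : {c : H | c ∈ S₀ ∧ C c = u • c}.Finite := by
    by_contra h
    exact huK ⟨hPu, h⟩
  have hYfin : ∀ i, {y : Y i | Φ i y = u ^ M i • y}.Finite := by
    intro i
    by_contra h
    exact huY (Set.mem_iUnion.2 ⟨i, Set.mem_iUnion₂.2 ⟨u ^ M i, h, rfl⟩⟩)
  have hF := finite_eigenclasses_of_detect C S S₀ r Φ M hker u (heig u) hYfin hKfin
  -- a uniform exponent on the finite eigenset
  have hk : ∀ c : {c : H | c ∈ S ∧ C c = u • c}, ∃ k : ℕ, p ^ k • (c : H) = 0 := fun c ↦ htor c c.2.1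
  choose k hk using hk
  haveI : Finite {c : H | c ∈ S ∧ C c = u • c} := hF.to_subtype
  obtain ⟨e, he⟩ := (Set.finite_range k).bddAbove
  refine ⟨e, fun c hc heq ↦ ?_⟩
  have hle : k ⟨c, hc, heq⟩ ≤ e := he (Set.mem_range_self _)
  obtain ⟨d, hd⟩ := Nat.exists_eq_add_of_le hle
  rw [hd, pow_add, mul_comm, mul_smul, hk ⟨c, hc, heq⟩, smul_zero]

end Summit.BirchSwinnertonDyer.BirchSwinnertonDyer.Theorems.SignedEC.EigenGlue
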